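import Literature.IUT.LogVolume.HullCaseModel
import HarnessLib

/-!
# [IUTchIII] Remark 3.9.5 (iii), last sentence, in the model: WITHOUT the condition `H ⊆ φ(P)` the
# log-volume hull-approximants are NOT confined to a compact set

Mochizuki, [IUTchIII] Rmk. 3.9.5 (iii), kurims p. 128 l.29–39 (read on the page): "this indeterminacy is
compact, i.e., in the sense that all possible choices of an element `∈ Φ(P)` or `∈ Ξ(P)` are contained in the
compact set `φ(P) ∈ Hul`. … Note that this compactness would not be valid if, in the definition of `Φ(−)` or
`Ξ(−)`, one omits the condition '`H ⊆ φ(P)`'."  Here `Φ(P) := {H ∈ Hul | φ(P) ⊇ H, μ^{log}(H) ≥ μ^{log}(P)}`.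

The layer-L6 statement file `Literature/IUT/LogThetaLattice/HolomorphicHull.lean` (abc-iut-L6-t4) and its
companion `HolomorphicHullRemarksProofs.lean` (`sUnion_volumeFamily_eq_univ`: without the condition, the union
of the family is everything as soon as every point lies in a member of `Hul` of log-volume `≥ μ^{log}(P)`) leave
the quantitative input to the model.  THIS proof-only file supplies it in campaign-S's CONSTRUCTED model
(abc-iut-S2 `HullModel.lean` / `HullCaseModel.lean`: finite direct sums `⊕_j K_j` of nonarchimedean local fields,
hull-sets `λ·𝒪_L = hullSet K λ`, weighted log-volume `boxLogVolume K w` of [IUTchIII] Rmk. 3.1.1 (iii) with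
POSITIVE weights):

* `exists_hullSet_mem_le_boxLogVolume` — for every point `x` and every bound `b` there is a hull-set
  `λ·𝒪_L ∋ x` with `μ^{log}(λ·𝒪_L) ≥ b` (take `λ_j = ϖ_j^{-n}`, `μ^{log} = n·Σ_j w_j·log q_j ↑ ∞`);
* `sUnion_hullSets_boxLogVolume_ge_eq_univ` — hence `⋃ {H ∈ Hul | μ^{log}(H) ≥ b} = 𝓘^ℚ((−))` for every `b`:
  omitting "`H ⊆ φ(P)`" from `Φ(P)`/`Ξ(P)`-style families destroys compactness, as printed.
[cite: Mochizuki2012, IUTchIII Rmk. 3.9.5 (iii) p. 128] [cite: MochizukiAbsTopIII2015, Prop. 5.7 (i)(b) p. 138]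
Deliberately NOT here: `Φ(P)`/`Ξ(P)` themselves (typed in L6), any judgement on [IUTchIII] Cor. 3.12 (Rmk. 3.9.5
(iii) is commentary; nothing disputed is asserted).
-/

noncomputable section

open MeasureTheory Set Metric TopologicalSpace Bornology
open scoped ENNReal NNReal Pointwise NormedField
open Literature.NumberTheory.GaloisRepresentations.Ultrametric

namespace Literature.IUT.LogVolume

variable {J : Type*} [Fintype J] (K : J → Type*) [∀ j, NontriviallyNormedField (K j)]
  [∀ j, IsUltrametricDist (K j)] [∀ j, ProperSpace (K j)] [∀ j, MeasurableSpace (K j)]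
  [∀ j, BorelSpace (K j)]

/-- **Hull-sets of arbitrarily large log-volume through any point** ([IUTchIII] Rmk. 3.9.5 (iii) p. 128, the
input to "this compactness would not be valid if … one omits the condition `H ⊆ φ(P)`"): for positive weights,
every `x ∈ ⊕_j K_j` and every `b ∈ ℝ` admit a hull-set `λ·𝒪_L ∋ x` (all `λ_j ∈ K_j^×`) with
`b ≤ μ^{log}(λ·𝒪_L)` — PROVED (`λ_j := ϖ_j^{-n}` for a common large `n`).
[cite: Mochizuki2012, IUTchIII Rmk. 3.9.5 (iii) p. 128] -/
theorem exists_hullSet_mem_le_boxLogVolume [Nonempty J] {w : J → ℝ} (hw : ∀ j, 0 < w j)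
    (x : Π j, K j) (b : ℝ) :
    ∃ c : Π j, (K j)ˣ, x ∈ hullSet K (fun j => (c j : K j)) ∧
      b ≤ boxLogVolume K w (hullSet K (fun j => (c j : K j))) := by
  classical
  -- uniformizers and the positive constant `S = Σ_j w_j log q_j`
  have hϖ : ∀ j, ∃ ϖ : (K j)ˣ, IsUniformizer ϖ := fun j => exists_isUniformizer (F := K j)
  choose ϖ hϖ using hϖ
  set S : ℝ := ∑ j, w j * Real.log (residueCard (K j)) with hS
  have hterm : ∀ j, 0 < w j * Real.log (residueCard (K j)) := fun j =>
    mul_pos (hw j) (Real.log_pos (one_lt_residueCard_real (K j)))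
  have hSpos : 0 < S := by
    rw [hS]
    exact Finset.sum_pos (fun j _ => hterm j) Finset.univ_nonempty
  -- per-coordinate exponents making `‖x j‖ ≤ ‖ϖ_j‖^{-N_j}`
  have hinv : ∀ j, 1 < ‖(ϖ j : K j)‖⁻¹ := fun j =>
    one_lt_inv_iff₀.mpr ⟨norm_pos_iff.mpr (ϖ j).ne_zero, (hϖ j).1⟩
  have hN : ∀ j, ∃ N : ℕ, ‖x j‖ ≤ (‖(ϖ j : K j)‖⁻¹) ^ N := fun j => by
    obtain ⟨N, hN⟩ := pow_unbounded_of_one_lt ‖x j‖ (hinv j)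
    exact ⟨N, hN.le⟩
  choose N hN using hN
  -- a volume exponent
  obtain ⟨n₀, hn₀⟩ := exists_nat_ge (b / S)
  set n : ℕ := (∑ j, N j) + n₀ with hn
  have hNle : ∀ j, N j ≤ n := fun j =>
    (Finset.single_le_sum (fun i _ => Nat.zero_le (N i)) (Finset.mem_univ j)).trans (Nat.le_add_right _ _)
  have hn₀le : n₀ ≤ n := Nat.le_add_left _ _
  refine ⟨fun j => (ϖ j) ^ (-(n : ℤ)), ?_, ?_⟩
  · -- membership: `‖x j‖ ≤ ‖ϖ_j‖^{-n}`
    show x ∈ polydisc K _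
    rw [mem_polydisc]
    intro j
    have hnorm : ‖(((ϖ j) ^ (-(n : ℤ)) : (K j)ˣ) : K j)‖ = (‖(ϖ j : K j)‖⁻¹) ^ n := by
      rw [Units.val_zpow_eq_zpow_val, norm_zpow, zpow_neg, zpow_natCast, inv_pow]
    rw [hnorm]
    exact (hN j).trans (pow_le_pow_right₀ (hinv j).le (hNle j))
  · -- volume: `Σ_j w_j · μ^log(ϖ_j^{-n}) = n · S ≥ n₀ · S ≥ b`
    rw [boxLogVolume_hullSet]
    have hvol : ∀ j, mulLogVolume (K j) ((ϖ j) ^ (-(n : ℤ))) = n * Real.log (residueCard (K j)) := by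
      intro j
      rw [mulLogVolume_uniformizer_zpow (K j) (hϖ j)]
      push_cast
      ring
    simp_rw [hvol]
    have hsum : ∑ j, w j * (↑n * Real.log (residueCard (K j))) = n * S := by
      rw [hS, Finset.mul_sum]
      refine Finset.sum_congr rfl fun j _ => ?_
      ring
    rw [hsum]
    have h1 : b ≤ n₀ * S := by
      have := (div_le_iff₀ hSpos).mp hn₀
      linarith
    have h2 : (n₀ : ℝ) * S ≤ n * S :=
      mul_le_mul_of_nonneg_right (by exact_mod_cast hn₀le) hSpos.le
    exact h1.trans h2

/-- **IUTchIII:Rmk3.9.5(iii)**, last sentence, IN THE MODEL (kurims p. 128: "this compactness would not be valid if,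
in the definition of `Φ(−)` or `Ξ(−)`, one omits the condition '`H ⊆ φ(P)`'"): for positive weights and every
bound `b`, the union of ALL hull-sets of log-volume `≥ b` is the whole space `⊕_j K_j` (not relatively compact) —
PROVED. [cite: Mochizuki2012, IUTchIII Rmk. 3.9.5 (iii) p. 128] -/
theorem sUnion_hullSets_boxLogVolume_ge_eq_univ [Nonempty J] {w : J → ℝ} (hw : ∀ j, 0 < w j) (b : ℝ) :
    ⋃₀ {H | H ∈ hullSets K ∧ b ≤ boxLogVolume K w H} = Set.univ := by
  refine Set.eq_univ_of_forall fun x => ?_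
  obtain ⟨c, hx, hb⟩ := exists_hullSet_mem_le_boxLogVolume K hw x b
  exact Set.mem_sUnion_of_mem hx ⟨⟨fun j => (c j : K j), fun j => (c j).ne_zero, rfl⟩, hb⟩

/-- The same with the log-volume bound taken from a region `P` (the printed `Φ(P)` without "`H ⊆ φ(P)`"):
`⋃ {H ∈ Hul | μ^{log}(H) ≥ μ^{log}(P)} = 𝓘^ℚ((−))`, so the family is not contained in any bounded set, in
particular not in the compact `φ(P)` — PROVED. [cite: Mochizuki2012, IUTchIII Rmk. 3.9.5 (iii) p. 128] -/
theorem not_isBounded_sUnion_hullSets_boxLogVolume_ge [Nonempty J] {w : J → ℝ} (hw : ∀ j, 0 < w j)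
    (P : Set (Π j, K j)) :
    ¬ IsBounded (⋃₀ {H | H ∈ hullSets K ∧ boxLogVolume K w P ≤ boxLogVolume K w H}) := by
  classical
  rw [sUnion_hullSets_boxLogVolume_ge_eq_univ K hw]
  intro hb
  obtain ⟨C, hC⟩ := isBounded_iff_forall_norm_le.mp hb
  obtain ⟨j₀⟩ := ‹Nonempty J›
  obtain ⟨r, hr⟩ := NormedField.exists_lt_norm (K j₀) C
  have h1 : ‖r‖ ≤ ‖(Pi.single j₀ r : Π j, K j)‖ := by
    simpa using norm_le_pi_norm (Pi.single j₀ r : Π j, K j) j₀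
  have h2 := hC (Pi.single j₀ r) (Set.mem_univ _)
  linarith

end Literature.IUT.LogVolume
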